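import Summits.CriticalPhenomena.PercolationContinuityZ3.Theorems.Transplant.PlanarSkeletonFrmFromDefs
import Summits.CriticalPhenomena.PercolationContinuityZ3.Theorems.Transplant.SkelFrmFromBChoiceRootReadX
import Summits.CriticalPhenomena.PercolationContinuityZ3.Theorems.Transplant.SkelFrmBChoiceRootReadX
import HarnessLib
import Summits.CriticalPhenomena.PercolationContinuityZ3.Theorems.Transplant.SkelFrmBChoiceRootReadX2
/-!
# U-WAVE PORT (RULING D-U, lead g21 2026-08-26; WAVE-U-MANIFEST v3.0 row «SkelFrmBChoiceRootReadX2» ↦ «SkelFrmFromBChoiceRootReadX2») of the tree module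
# `Transplant/SkelFrmBChoiceRootReadX2` onto the carrier `PlanarSkeletonFrmFrom` (frames only, cylinders connected from width `ℓ₀` on)

ORIGINAL TITLE: N2 (frames-only node `SamePDropOfSkeletonFrm₁`, OPEN), (R) column, reading rows: **THE FIRST-AXIS ROOT READINGS FROM BOX ROWS** —

builds on p205010 (kernel theorem, internal audit signed; external expert review pending) — nothing in this file uses p205010; NOTHING is claimed about the
OPEN node U `SamePDropOfSkeletonFrmFrom₁` (nor U_s / the end state).  Lane `prim-bschramm`, seat `prim-hp-8 gen 53 (U-wave port pen, family P-hp8; tool of record = p3-g26 port_u.py)`; helper file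
(`--supports stmt-CriticalPhenomena-4575 --as helper`).  PORT RULES r1–r4 of RULING D-U: declaration order and proof texts are those of the original,
byte-identical except (i) the carrier token `PlanarSkeletonFrm ↦ PlanarSkeletonFrmFrom` (binders, `namespace`/`end` lines, qualified names of twinned
declarations), (ii) carrier-FREE declarations of the original (φ-level `Skelφ…` blocks and namespace-only arithmetic residents) are NOT re-declared —
this file imports the original and `export`s the twin-free residents (POLICY T / treatment (m1)); residents whose statement mentions a twinned
constant are copied, (iii) every carrier-binding declaration keeps its explicit binder `(Φ : PlanarSkeletonFrmFrom G)` in its own signature (r2).  Docstrings and citations are the original's.  Manifest row idx 179 (level 19; flags verbatim|RESIDENTS(T:0/free:2)); filed by the hp-8 lineage under RULING M-11 (family P-hp8).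
-/

noncomputable section

open scoped Classical

namespace Summit.CriticalPhenomena.PercolationContinuityZ3.Theorems.Transplant

open MeasureTheory Literature.Probability.Percolation Literature.Probability.LatticeModels SimpleGraph KNCells KNLevels ChainPlanar ChainPara
open Literature.Probability.Percolation.KozmaNitzan.Cells (oth sgOf)
open Literature.Barriers.CriticalPhenomena (graphBall)
open SkelConc (Consts)
open Skelφ (rootFrame RootFootT TargetFootT shearUnit kgSL kgZ₀ kgZ₁ kgM₁ kgM₂ kgWm₂ kgWp₂ kgA₁ kgFar rdLo rdHi KGRows)
open TwoAxis.Para (modulus)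
open ChainPlanar (ScheduleNP BridgePrm)

namespace PlanarSkeletonFrmFrom

namespace NegB

open Neg

namespace KS

section ReadX2

variable (κ : Consts) {V : Type} [DecidableEq V] [Countable V] {G : SimpleGraph V} [G.LocallyFinite] (Φ : PlanarSkeletonFrmFrom G) (t : V) (p : unitInterval)
  (D : Skelφ.StepI.DataNS V) (mk g f qx Wx : ℕ) (c : Fin 2 → ℕ)

/-! ## §1 The footprint predicates from fine bounds -/

export PlanarSkeletonFrm.NegB.KS (rootFootT_fst_of_bounds)

export PlanarSkeletonFrm.NegB.KS (targetFootT_fst_of_bounds)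

/-! ## §2 The three rows of the skeleton from two box-reading rows -/

set_option maxHeartbeats 1600000 in
/-- **`hfoot₂` OF THE FIRST-AXIS (R) SKELETON FROM ONE BOX-READING ROW**: every region of the root corridor at any landing `c₁* = t + (X1, Y1s)` reads inside
`RootFootT` (cells `fcellsT … c`, any creep value `c`). [cite: KozmaNitzan2024, §4 p. 28 ((32) at the root)] -/
theorem hfoot₂_R (κ : Consts) {V : Type} [DecidableEq V] [Countable V] {G : SimpleGraph V} [G.LocallyFinite] (Φ : PlanarSkeletonFrmFrom G) (t : V) (p : unitInterval) (D : Skelφ.StepI.DataNS V) (mk : ℕ) (g : ℕ) (f : ℕ) (qx : ℕ) (Wx : ℕ) (c : Fin 2 → ℕ) (hN : EqNumL κ Φ t p D g f) (hg : gFloorKG κ Φ t p D mk ≤ g) (hg2 : 40 * Neg.K κ * KS0.R'0 κ Φ t p D mk ≤ g)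
    (hqx : qx ≤ 100 * nL κ Φ t p D g f) (hWx : (Wx : ℤ) ≤ 20 * (kgSL (nL κ Φ t p D g f) (ℓL κ Φ t p D g f) (hL κ Φ t p D g f))) (hf : KS.fxR0 κ Φ t p D mk ≤ f)
    {lo hi : Site 2}
    (hlo0 : lo 0 ≤ -kgZ₀ (nL κ Φ t p D g f) (vL κ Φ t p D g f) (kgR κ Φ t p D mk) 0 (kgq κ Φ t p D g f qx) (kgNv0 κ Φ t p D g f mk qx Wx) (kgM₁ (nL κ Φ t p D g f) (ℓL κ Φ t p D g f) (hL κ Φ t p D g f) (kgR κ Φ t p D mk) 0 (kgW κ Φ t p D g f Wx) (kgNv0 κ Φ t p D g f mk qx Wx)) (kgM₂ (nL κ Φ t p D g f) (ℓL κ Φ t p D g f) (hL κ Φ t p D g f) (vL κ Φ t p D g f) (kgR κ Φ t p D mk) 0 (kgq κ Φ t p D g f qx) (kgW κ Φ t p D g f Wx) (kgNv0 κ Φ t p D g f mk qx Wx)))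
    (hhi0 : ((((kgNv0 κ Φ t p D g f mk qx Wx) : ℕ) : ℤ) + 1) * (nL κ Φ t p D g f : ℤ) + kgZ₀ (nL κ Φ t p D g f) (vL κ Φ t p D g f) (kgR κ Φ t p D mk) 0 (kgq κ Φ t p D g f qx) (kgNv0 κ Φ t p D g f mk qx Wx) (kgM₁ (nL κ Φ t p D g f) (ℓL κ Φ t p D g f) (hL κ Φ t p D g f) (kgR κ Φ t p D mk) 0 (kgW κ Φ t p D g f Wx) (kgNv0 κ Φ t p D g f mk qx Wx)) (kgM₂ (nL κ Φ t p D g f) (ℓL κ Φ t p D g f) (hL κ Φ t p D g f) (vL κ Φ t p D g f) (kgR κ Φ t p D mk) 0 (kgq κ Φ t p D g f qx) (kgW κ Φ t p D g f Wx) (kgNv0 κ Φ t p D g f mk qx Wx)) + 4 * (nL κ Φ t p D g f : ℤ) + qx ≤ hi 0)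
    (hlo1 : lo 1 ≤ -(kgZ₁ (nL κ Φ t p D g f) (ℓL κ Φ t p D g f) (hL κ Φ t p D g f) (kgR κ Φ t p D mk) 0 (kgW κ Φ t p D g f Wx) (kgNv0 κ Φ t p D g f mk qx Wx) (kgM₁ (nL κ Φ t p D g f) (ℓL κ Φ t p D g f) (hL κ Φ t p D g f) (kgR κ Φ t p D mk) 0 (kgW κ Φ t p D g f Wx) (kgNv0 κ Φ t p D g f mk qx Wx)) (kgWm₂ (nL κ Φ t p D g f) (ℓL κ Φ t p D g f) (hL κ Φ t p D g f) (kgR κ Φ t p D mk) 0 (kgW κ Φ t p D g f Wx) (kgNv0 κ Φ t p D g f mk qx Wx)) (kgWp₂ (nL κ Φ t p D g f) (ℓL κ Φ t p D g f) (hL κ Φ t p D g f) (kgR κ Φ t p D mk) 0 (kgW κ Φ t p D g f Wx) (kgNv0 κ Φ t p D g f mk qx Wx)) (kgM₂ (nL κ Φ t p D g f) (ℓL κ Φ t p D g f) (hL κ Φ t p D g f) (vL κ Φ t p D g f) (kgR κ Φ t p D mk) 0 (kgq κ Φ t p D g f qx) (kgW κ Φ t p D g f Wx) (kgNv0 κ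 Φ t p D g f mk qx Wx)) + kgSL (nL κ Φ t p D g f) (ℓL κ Φ t p D g f) (hL κ Φ t p D g f)))
    (hhi1 : kgZ₁ (nL κ Φ t p D g f) (ℓL κ Φ t p D g f) (hL κ Φ t p D g f) (kgR κ Φ t p D mk) 0 (kgW κ Φ t p D g f Wx) (kgNv0 κ Φ t p D g f mk qx Wx) (kgM₁ (nL κ Φ t p D g f) (ℓL κ Φ t p D g f) (hL κ Φ t p D g f) (kgR κ Φ t p D mk) 0 (kgW κ Φ t p D g f Wx) (kgNv0 κ Φ t p D g f mk qx Wx)) (kgWm₂ (nL κ Φ t p D g f) (ℓL κ Φ t p D g f) (hL κ Φ t p D g f) (kgR κ Φ t p D mk) 0 (kgW κ Φ t p D g f Wx) (kgNv0 κ Φ t p D g f mk qx Wx)) (kgWp₂ (nL κ Φ t p D g f) (ℓL κ Φ t p D g f) (hL κ Φ t p D g f) (kgR κ Φ t p D mk) 0 (kgW κ Φ t p D g f Wx) (kgNv0 κ Φ t p D g f mk qx Wx)) (kgM₂ (nL κ Φ t p D g f) (ℓL κ Φ t p D g f) (hL κ Φ t p D g f) (vL κ Φ t p D g f) (kgR κ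 Φ t p D mk) 0 (kgq κ Φ t p D g f qx) (kgW κ Φ t p D g f Wx) (kgNv0 κ Φ t p D g f mk qx Wx)) + kgSL (nL κ Φ t p D g f) (ℓL κ Φ t p D g f) (hL κ Φ t p D g f) ≤ hi 1)
    (hrow : -(5 * (((fcellsA κ Φ t p D g f).r 0 : ℕ) : ℤ)) + 1 ≤ rdLo (Aof κ) (nL κ Φ t p D g f) (hL κ Φ t p D g f) (vL κ Φ t p D g f) (vβL κ Φ t p D g f) (prFA κ Φ t p D g f).c₀ (prFA κ Φ t p D g f).c₁ (prFA κ Φ t p D g f).D lo hi 0 ∧ rdHi (Aof κ) (nL κ Φ t p D g f) (hL κ Φ t p D g f) (vL κ Φ t p D g f) (vβL κ Φ t p D g f) (prFA κ Φ t p D g f).c₀ (prFA κ Φ t p D g f).c₁ (prFA κ Φ t p D g f).D lo hi 0 ≤ 25 * (((fcellsA κ Φ t p D g f).r 0 : ℕ) : ℤ) - 1 ∧ -(3 * (((fcellsA κ Φ t p D g f).r 1 : ℕ) : ℤ)) + 1 ≤ rdLo (Aof κ) (nL κ Φ t p D g f) (hL κ Φ t p D g f) (vL κ Φ t p D g f)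 (vβL κ Φ t p D g f) (prFA κ Φ t p D g f).c₀ (prFA κ Φ t p D g f).c₁ (prFA κ Φ t p D g f).D lo hi 1 ∧ rdHi (Aof κ) (nL κ Φ t p D g f) (hL κ Φ t p D g f) (vL κ Φ t p D g f) (vβL κ Φ t p D g f) (prFA κ Φ t p D g f).c₀ (prFA κ Φ t p D g f).c₁ (prFA κ Φ t p D g f).D lo hi 1 ≤ 3 * (((fcellsA κ Φ t p D g f).r 1 : ℕ) : ℤ) - 1)
    {φ' : V → Site 2} {c₁ : V} (hX : φ' c₁ 0 - φ' t 0 = (X1 κ Φ t p D mk g f (kgq κ Φ t p D g f qx))) (hY : φ' c₁ 1 - φ' t 1 = (Y1s κ Φ t p D mk g f (kgq κ Φ t p D g f qx))) :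
    ∀ k ≤ (Skelφ.kgCorrSched ((kgRows0_of κ Φ t p D g f mk qx Wx hN hg).kgVals_ok₁ (KS.kgNR κ Φ t p D mk g f qx Wx)) ((kgRows0_of κ Φ t p D g f mk qx Wx hN hg).kgVals_ok₂ (KS.kgNR κ Φ t p D mk g f qx Wx)) ((kgRows0_of κ Φ t p D g f mk qx Wx hN hg).kgVals_split (KS.kgNR κ Φ t p D mk g f qx Wx))).N, ∀ w : V, Skelφ.runX φ' c₁ (nL κ Φ t p D g f) (hL κ Φ t p D g f) 1 w ∈ (Skelφ.kgCorrSched ((kgRows0_of κ Φ t p D g f mk qx Wx hN hg).kgVals_ok₁ (KS.kgNR κ Φ t p D mk g f qx Wx)) ((kgRows0_of κ Φ t p D g f mk qx Wx hN hg).kgVals_ok₂ (KS.kgNR κ Φ t p D mk g f qx Wx)) ((kgRows0_of κ Φ t p D g f mk qx Wx hN hg).kgVals_split (KS.kgNR κ Φ t p D mk g f qx Wx))).region k →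
      RootFootT (fcellsT κ Φ t p D g f c) (((0 : Fin 2), true) : MDir) (fineA κ Φ t p D g f φ' w) := by
  intro k hk w hw
  have hb := rootRegion_mem_box κ Φ t p D mk g f qx Wx hN hg hg2 hqx hWx hf hX hY hlo0 hhi0 hlo1 hhi1 hk hw
  have h0 := fine_mem_rd_root κ Φ t p D g f hN hb 0
  have h1 := fine_mem_rd_root κ Φ t p D g f hN hb 1
  obtain ⟨-, -, -, -, -, -, -, -, hkq, hr40⟩ := hsc_Q κ Φ t p D g f hN
  obtain ⟨hl0, hu0, hl1, hu1⟩ := hrow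
  have hr1 : 1 ≤ (fcellsT κ Φ t p D g f c).r 1 := by
    have h := hr40 1; rw [fcellsT_r]; have hk : (1 : ℤ) ≤ ((Neg.Kq κ : ℕ) : ℤ) := by exact_mod_cast hkq
    have : (1 : ℤ) ≤ (((fcellsA κ Φ t p D g f).r 1 : ℕ) : ℤ) := by linarith
    exact_mod_cast this
  exact rootFootT_fst_of_bounds (fcellsT κ Φ t p D g f c) (by rw [fcellsT_r]; linarith [h0.1]) (by rw [fcellsT_r]; linarith [h0.2])
    (by rw [fcellsT_r]; linarith [h1.1]) (by rw [fcellsT_r]; linarith [h1.2]) hr1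

set_option maxHeartbeats 1600000 in
/-- **`hfoot₁` OF THE FIRST-AXIS (R) SKELETON FROM THE SAME BOX-READING ROW**: the bridge region reads inside `RootFootT`. [cite: KozmaNitzan2024, §4 p. 28] -/
theorem hfoot₁_R (κ : Consts) {V : Type} [DecidableEq V] [Countable V] {G : SimpleGraph V} [G.LocallyFinite] (Φ : PlanarSkeletonFrmFrom G) (t : V) (p : unitInterval) (D : Skelφ.StepI.DataNS V) (mk : ℕ) (g : ℕ) (f : ℕ) (qx : ℕ) (Wx : ℕ) (c : Fin 2 → ℕ) (hN : EqNumL κ Φ t p D g f) (hf : KS.fxR0 κ Φ t p D mk ≤ f) (hfg : 2 * f + 5 * KS0.R'0 κ Φ t p D mk + 3 ≤ g)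
    {lo hi : Site 2}
    (hlo0 : lo 0 ≤ -kgZ₀ (nL κ Φ t p D g f) (vL κ Φ t p D g f) (kgR κ Φ t p D mk) 0 (kgq κ Φ t p D g f qx) (kgNv0 κ Φ t p D g f mk qx Wx) (kgM₁ (nL κ Φ t p D g f) (ℓL κ Φ t p D g f) (hL κ Φ t p D g f) (kgR κ Φ t p D mk) 0 (kgW κ Φ t p D g f Wx) (kgNv0 κ Φ t p D g f mk qx Wx)) (kgM₂ (nL κ Φ t p D g f) (ℓL κ Φ t p D g f) (hL κ Φ t p D g f) (vL κ Φ t p D g f) (kgR κ Φ t p D mk) 0 (kgq κ Φ t p D g f qx) (kgW κ Φ t p D g f Wx) (kgNv0 κ Φ t p D g f mk qx Wx)))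
    (hhi0 : ((((kgNv0 κ Φ t p D g f mk qx Wx) : ℕ) : ℤ) + 1) * (nL κ Φ t p D g f : ℤ) + kgZ₀ (nL κ Φ t p D g f) (vL κ Φ t p D g f) (kgR κ Φ t p D mk) 0 (kgq κ Φ t p D g f qx) (kgNv0 κ Φ t p D g f mk qx Wx) (kgM₁ (nL κ Φ t p D g f) (ℓL κ Φ t p D g f) (hL κ Φ t p D g f) (kgR κ Φ t p D mk) 0 (kgW κ Φ t p D g f Wx) (kgNv0 κ Φ t p D g f mk qx Wx)) (kgM₂ (nL κ Φ t p D g f) (ℓL κ Φ t p D g f) (hL κ Φ t p D g f) (vL κ Φ t p D g f) (kgR κ Φ t p D mk) 0 (kgq κ Φ t p D g f qx) (kgW κ Φ t p D g f Wx) (kgNv0 κ Φ t p D g f mk qx Wx)) + 4 * (nL κ Φ t p D g f : ℤ) + qx ≤ hi 0)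
    (hlo1 : lo 1 ≤ -(kgZ₁ (nL κ Φ t p D g f) (ℓL κ Φ t p D g f) (hL κ Φ t p D g f) (kgR κ Φ t p D mk) 0 (kgW κ Φ t p D g f Wx) (kgNv0 κ Φ t p D g f mk qx Wx) (kgM₁ (nL κ Φ t p D g f) (ℓL κ Φ t p D g f) (hL κ Φ t p D g f) (kgR κ Φ t p D mk) 0 (kgW κ Φ t p D g f Wx) (kgNv0 κ Φ t p D g f mk qx Wx)) (kgWm₂ (nL κ Φ t p D g f) (ℓL κ Φ t p D g f) (hL κ Φ t p D g f) (kgR κ Φ t p D mk) 0 (kgW κ Φ t p D g f Wx) (kgNv0 κ Φ t p D g f mk qx Wx)) (kgWp₂ (nL κ Φ t p D g f) (ℓL κ Φ t p D g f) (hL κ Φ t p D g f) (kgR κ Φ t p D mk) 0 (kgW κ Φ t p D g f Wx) (kgNv0 κ Φ t p D g f mk qx Wx)) (kgM₂ (nL κ Φ t p D g f) (ℓL κ Φ t p D g f) (hL κ Φ t p D g f) (vL κ Φ t p D g f) (kgR κ Φ t p D mk) 0 (kgq κ Φ t p D g f qx) (kgW κ Φ t p D g f Wx) (kgNv0 κ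 Φ t p D g f mk qx Wx)) + kgSL (nL κ Φ t p D g f) (ℓL κ Φ t p D g f) (hL κ Φ t p D g f)))
    (hhi1 : kgZ₁ (nL κ Φ t p D g f) (ℓL κ Φ t p D g f) (hL κ Φ t p D g f) (kgR κ Φ t p D mk) 0 (kgW κ Φ t p D g f Wx) (kgNv0 κ Φ t p D g f mk qx Wx) (kgM₁ (nL κ Φ t p D g f) (ℓL κ Φ t p D g f) (hL κ Φ t p D g f) (kgR κ Φ t p D mk) 0 (kgW κ Φ t p D g f Wx) (kgNv0 κ Φ t p D g f mk qx Wx)) (kgWm₂ (nL κ Φ t p D g f) (ℓL κ Φ t p D g f) (hL κ Φ t p D g f) (kgR κ Φ t p D mk) 0 (kgW κ Φ t p D g f Wx) (kgNv0 κ Φ t p D g f mk qx Wx)) (kgWp₂ (nL κ Φ t p D g f) (ℓL κ Φ t p D g f) (hL κ Φ t p D g f) (kgR κ Φ t p D mk) 0 (kgW κ Φ t p D g f Wx) (kgNv0 κ Φ t p D g f mk qx Wx)) (kgM₂ (nL κ Φ t p D g f) (ℓL κ Φ t p D g f) (hL κ Φ t p D g f) (vL κ Φ t p D g f) (kgR κ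 Φ t p D mk) 0 (kgq κ Φ t p D g f qx) (kgW κ Φ t p D g f Wx) (kgNv0 κ Φ t p D g f mk qx Wx)) + kgSL (nL κ Φ t p D g f) (ℓL κ Φ t p D g f) (hL κ Φ t p D g f) ≤ hi 1)
    (hrow : -(5 * (((fcellsA κ Φ t p D g f).r 0 : ℕ) : ℤ)) + 1 ≤ rdLo (Aof κ) (nL κ Φ t p D g f) (hL κ Φ t p D g f) (vL κ Φ t p D g f) (vβL κ Φ t p D g f) (prFA κ Φ t p D g f).c₀ (prFA κ Φ t p D g f).c₁ (prFA κ Φ t p D g f).D lo hi 0 ∧ rdHi (Aof κ) (nL κ Φ t p D g f) (hL κ Φ t p D g f) (vL κ Φ t p D g f) (vβL κ Φ t p D g f) (prFA κ Φ t p D g f).c₀ (prFA κ Φ t p D g f).c₁ (prFA κ Φ t p D g f).D lo hi 0 ≤ 25 * (((fcellsA κ Φ t p D g f).r 0 : ℕ) : ℤ) - 1 ∧ -(3 * (((fcellsA κ Φ t p D g f).r 1 : ℕ) : ℤ)) + 1 ≤ rdLo (Aof κ) (nL κ Φ t p D g f) (hL κ Φ t p D g f) (vL κ Φ t p D g f)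 (vβL κ Φ t p D g f) (prFA κ Φ t p D g f).c₀ (prFA κ Φ t p D g f).c₁ (prFA κ Φ t p D g f).D lo hi 1 ∧ rdHi (Aof κ) (nL κ Φ t p D g f) (hL κ Φ t p D g f) (vL κ Φ t p D g f) (vβL κ Φ t p D g f) (prFA κ Φ t p D g f).c₀ (prFA κ Φ t p D g f).c₁ (prFA κ Φ t p D g f).D lo hi 1 ≤ 3 * (((fcellsA κ Φ t p D g f).r 1 : ℕ) : ℤ) - 1)
    {φ' : V → Site 2} :
    ∀ w : V, rootFrame φ' t 1 w ∈ Finset.Icc (B0 κ Φ t p D mk g f).regionLo (B0 κ Φ t p D mk g f).regionHi →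
      RootFootT (fcellsT κ Φ t p D g f c) (((0 : Fin 2), true) : MDir) (fineA κ Φ t p D g f φ' w) := by
  intro w hw
  have hb := bridgeRegion_mem_box κ Φ t p D mk g f qx Wx hN hf hfg hlo0 hhi0 hlo1 hhi1 hw
  have h0 := fine_mem_rd_root κ Φ t p D g f hN hb 0
  have h1 := fine_mem_rd_root κ Φ t p D g f hN hb 1
  obtain ⟨-, -, -, -, -, -, -, -, hkq, hr40⟩ := hsc_Q κ Φ t p D g f hN
  obtain ⟨hl0, hu0, hl1, hu1⟩ := hrow
  have hr1 : 1 ≤ (fcellsT κ Φ t p D g f c).r 1 := by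
    have h := hr40 1; rw [fcellsT_r]; have hk : (1 : ℤ) ≤ ((Neg.Kq κ : ℕ) : ℤ) := by exact_mod_cast hkq
    have : (1 : ℤ) ≤ (((fcellsA κ Φ t p D g f).r 1 : ℕ) : ℤ) := by linarith
    exact_mod_cast this
  exact rootFootT_fst_of_bounds (fcellsT κ Φ t p D g f c) (by rw [fcellsT_r]; linarith [h0.1]) (by rw [fcellsT_r]; linarith [h0.2])
    (by rw [fcellsT_r]; linarith [h1.1]) (by rw [fcellsT_r]; linarith [h1.2]) hr1

set_option maxHeartbeats 1600000 in
/-- **`hlastf` OF THE FIRST-AXIS (R) SKELETON FROM ONE ARRIVAL-BOX READING ROW**: the root corridor's last core reads inside `TargetFootT … b` (arrival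
cube `b`, creep value `(fcellsT … c).c 0`). [cite: KozmaNitzan2024, §4 p. 28 ((32) at the root)] -/
theorem hlastf_R (κ : Consts) {V : Type} [DecidableEq V] [Countable V] {G : SimpleGraph V} [G.LocallyFinite] (Φ : PlanarSkeletonFrmFrom G) (t : V) (p : unitInterval) (D : Skelφ.StepI.DataNS V) (mk : ℕ) (g : ℕ) (f : ℕ) (qx : ℕ) (Wx : ℕ) (c : Fin 2 → ℕ) (hN : EqNumL κ Φ t p D g f) (hg : gFloorKG κ Φ t p D mk ≤ g) (hg2 : 40 * Neg.K κ * KS0.R'0 κ Φ t p D mk ≤ g)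
    (hqx : qx ≤ 100 * nL κ Φ t p D g f) (hWx : (Wx : ℤ) ≤ 20 * (kgSL (nL κ Φ t p D g f) (ℓL κ Φ t p D g f) (hL κ Φ t p D g f))) (hf : KS.fxR0 κ Φ t p D mk ≤ f)
    (h0C : (kgFar (nL κ Φ t p D g f) (ℓL κ Φ t p D g f) (hL κ Φ t p D g f) (vL κ Φ t p D g f) (kgR κ Φ t p D mk) 0 (kgq κ Φ t p D g f qx) (kgW κ Φ t p D g f Wx) 0) ≤ (kgTgt0 κ Φ t p D g f mk))
    (b : Fin 2 → ℕ) {lo hi : Site 2}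
    (hlo0 : lo 0 ≤ ((kgRows0_of κ Φ t p D g f mk qx Wx hN hg).kgLastLo (kgNv0 κ Φ t p D g f mk qx Wx)) 0 - 3 * (nL κ Φ t p D g f : ℤ))
    (hhi0 : ((kgRows0_of κ Φ t p D g f mk qx Wx hN hg).kgLastHi (kgNv0 κ Φ t p D g f mk qx Wx)) 0 + 3 * (nL κ Φ t p D g f : ℤ) ≤ hi 0)
    (hlo1 : lo 1 ≤ ((kgRows0_of κ Φ t p D g f mk qx Wx hN hg).kgLastLo (kgNv0 κ Φ t p D g f mk qx Wx)) 1 - 2 * (kgSL (nL κ Φ t p D g f) (ℓL κ Φ t p D g f) (hL κ Φ t p D g f)))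
    (hhi1 : ((kgRows0_of κ Φ t p D g f mk qx Wx hN hg).kgLastHi (kgNv0 κ Φ t p D g f mk qx Wx)) 1 + 1 ≤ hi 1)
    (hrow : 20 * (((fcellsA κ Φ t p D g f).r 0 : ℕ) : ℤ) - (b 0 : ℤ) + 1 ≤ rdLo (Aof κ) (nL κ Φ t p D g f) (hL κ Φ t p D g f) (vL κ Φ t p D g f) (vβL κ Φ t p D g f) (prFA κ Φ t p D g f).c₀ (prFA κ Φ t p D g f).c₁ (prFA κ Φ t p D g f).D lo hi 0 ∧ rdHi (Aof κ) (nL κ Φ t p D g f) (hL κ Φ t p D g f) (vL κ Φ t p D g f) (vβL κ Φ t p D g f) (prFA κ Φ t p D g f).c₀ (prFA κ Φ t p D g f).c₁ (prFA κ Φ t p D g f).D lo hi 0 ≤ 20 * (((fcellsA κ Φ t p D g f).r 0 : ℕ) : ℤ) + (b 0 : ℤ) - 1 ∧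
      ((fcellsT κ Φ t p D g f c).c 0 : ℤ) - (b 1 : ℤ) + 1 ≤ rdLo (Aof κ) (nL κ Φ t p D g f) (hL κ Φ t p D g f) (vL κ Φ t p D g f) (vβL κ Φ t p D g f) (prFA κ Φ t p D g f).c₀ (prFA κ Φ t p D g f).c₁ (prFA κ Φ t p D g f).D lo hi 1 ∧ rdHi (Aof κ) (nL κ Φ t p D g f) (hL κ Φ t p D g f) (vL κ Φ t p D g f) (vβL κ Φ t p D g f) (prFA κ Φ t p D g f).c₀ (prFA κ Φ t p D g f).c₁ (prFA κ Φ t p D g f).D lo hi 1 ≤ ((fcellsT κ Φ t p D g f c).c 0 : ℤ) + (b 1 : ℤ) - 1)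
    {φ' : V → Site 2} {c₁ : V} (hX : φ' c₁ 0 - φ' t 0 = (X1 κ Φ t p D mk g f (kgq κ Φ t p D g f qx))) (hY : φ' c₁ 1 - φ' t 1 = (Y1s κ Φ t p D mk g f (kgq κ Φ t p D g f qx))) :
    ∀ w : V, Skelφ.runX φ' c₁ (nL κ Φ t p D g f) (hL κ Φ t p D g f) 1 w ∈ ScheduleNP.core (Skelφ.kgCorrSched ((kgRows0_of κ Φ t p D g f mk qx Wx hN hg).kgVals_ok₁ (KS.kgNR κ Φ t p D mk g f qx Wx)) ((kgRows0_of κ Φ t p D g f mk qx Wx hN hg).kgVals_ok₂ (KS.kgNR κ Φ t p D mk g f qx Wx)) ((kgRows0_of κ Φ t p D g f mk qx Wx hN hg).kgVals_split (KS.kgNR κ Φ t p D mk g f qx Wx))) ((Skelφ.kgCorrSched ((kgRows0_of κ Φ t p D g f mk qx Wx hN hg).kgVals_ok₁ (KS.kgNR κ Φ t p D mk g f qx Wx)) ((kgRows0_of κ Φ t p D g f mk qx Wx hN hg).kgVals_ok₂ (KS.kgNR κ Φ t p D mk g f qx Wx)) ((kgRows0_of κ Φ t p D g f mk qx Wx hN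 hg).kgVals_split (KS.kgNR κ Φ t p D mk g f qx Wx))).N + 1) →
      TargetFootT (fcellsT κ Φ t p D g f c) b (((0 : Fin 2), true) : MDir) (fineA κ Φ t p D g f φ' w) := by
  intro w hw
  have hb := rootLast_mem_box κ Φ t p D mk g f qx Wx hN hg hg2 hqx hWx hf h0C hX hY hlo0 hhi0 hlo1 hhi1 hw
  have h0 := fine_mem_rd_root κ Φ t p D g f hN hb 0
  have h1 := fine_mem_rd_root κ Φ t p D g f hN hb 1
  obtain ⟨hl0, hu0, hl1, hu1⟩ := hrow
  exact targetFootT_fst_of_bounds (fcellsT κ Φ t p D g f c) b (by rw [fcellsT_r]; linarith [h0.1]) (by rw [fcellsT_r]; linarith [h0.2])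
    (by linarith [h1.1]) (by linarith [h1.2])

end ReadX2

end KS

end NegB

end PlanarSkeletonFrmFrom

end Summit.CriticalPhenomena.PercolationContinuityZ3.Theorems.Transplant

end
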